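import Literature.Probability.Percolation.TriBlockIteration
import Literature.Probability.Percolation.NearCriticalArm
import Literature.Probability.Percolation.TriSubcriticalCrossingProofs
import Literature.Probability.Percolation.NearCriticalCorrelationLengthLower
import HarnessLib

/-!
# Uniform exponential decay above `L(p)` from RSW and the block argument (proofs only)

Topic `Literature/Probability/Percolation`; family `crit-perc`. Layer 4 of the bottom-up
discharge of **crit-perc.S16** (`Literature.Probability.Percolation.triTheta_exponent`), proofs only (no new named
fact). The leaf `Nolin2008_lemma39` (`NearCriticalArm.lean`: uniform exponential decay of
easy-way crossings above the characteristic length, Nolin 2008, Lemma 39 with Remark 40) is PROVED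
for all `ε` below a universal threshold `ε₀` (`Nolin2008_lemma39_small`) from the tree's named
fact `Nolin2008_RSW_one` (`NearCriticalCorrelationLengthLower.lean`: the "moreover" clause
`f_k(δ) → 1` as `δ → 1` of Nolin's Russo–Seymour–Welsh theorem, itself derived there from the
printed theorem `Nolin2008_RSW_thm`), used ONCE, for `k = 2` and `η = 1/(100 e)`, to start the
block iteration; the rest is the block argument of `TriBlockCrossing.lean` /
`TriBlockIteration.lean` and elementary geometry. The finiteness of `L_ε(p)`
(`Nolin2008_subcritical_crossing`, `KestenRelationRusso.lean`) is now a theorem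
(`Nolin2008_subcritical_crossing_holds`, from `BollobasRiordan2006_tri_expDecay_holds`,
`TriSubcriticalCrossingProofs.lean`), as are RSW at `1/2` (`tri_rsw_half_holds`) and
`θ(1/2) = 0` (`TriThetaHalf.lean`). Consequently crit-perc.S16 is reduced to FIVE named facts of
the tree, none introduced here: `triTheta_exponent_of_leaves5` — the critical arm exponents
`oneArm_exponent` (`5/48`) and `fourArm_exponent` (`5/4`), the pivotal count below `L(p)`
(`Werner2009_lemma62`), the near-critical stability of one arm (`Nolin2008_thm27_oneArm`), and
`Nolin2008_RSW_one`. By-product for the correlation-length route (`triCorrLength_exponent`):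
`Nolin2008_lemma39_at_small` gives `Nolin2008_lemma39_at ε` (`NearCriticalCorrelationLength.lean`)
for every `ε ≤ ε₀`.

This is exactly the part of Nolin's proof of Lemma 39 that does not use "the equivalence of
lengths for different values of `ε`" (Cor. 35, needed only to pass from small `ε` to every
`ε ∈ (0, 1/2)`; Nolin: "we have proved the property for any `ε` below some fixed value `ε₀`
(given by RSW)"). Since the assembly of `triTheta_exponent` needs ONE `ε` only
(`triTheta_exponent_of_scaling_at`, `Nolin2008_cor41_at_of_ladder`), small `ε` suffices.

**Proof** (Nolin 2008, proof of Lemma 39 [arXiv 0711.4948: Lemma 37], eqs. (7.21)–(7.23) and the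
final display; Remark 40 [arXiv: Remark 38]).
* Start: with `L = L_ε(p)` (`ε < p < 1/2`), `P_p(LR(L, L)) ≤ ε`, so by Hex duality and
  transposition (`triLRCrossingProb_add_eq_one`) `P_{1-p}(LR(L, L)) ≥ 1 - ε ≥ δ₀`, whence by
  `Nolin2008_RSW_one` (`k = 2`, `η = 1/(100 e)`) `P_{1-p}(LR(2L, L)) ≥ 1 - 1/(100 e)`, i.e. the
  easy crossing `q₀ = P_p(LR(L, 2L)) ≤ 1/(100 e)` once `ε ≤ ε₀ := 1 - δ₀` (Nolin: "The RSW theory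
  thus entails that for all fixed `ε₁ > 0`, we can take `ε₀` sufficiently small to get …
  `P_p(C_H([0, L(p)] × [0, 2L(p)])) ≤ ε₁`"): `triLRCrossingProb_charLength_easy_le`.
* Squares: the block iteration (`triLRCrossingProb_block_iterate`, `C' = 100`) gives
  `100 P_p(LR(a_j, 2a_j)) ≤ e^{-2^j}` along `a_j + 1 = 2^j (L + 1)`, and for `n ≥ L`,
  `a_j ≤ n ≤ 2 a_j` for the right `j` gives `P_p(LR(n, n)) ≤ P_p(LR(a_j, 2a_j)) ≤ e^{-n/(4L)}/100`
  (`triLRCrossingProb_square_le_easy`); small `n < L` are absorbed in the constant: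
  `P_p(LR(n, n)) ≤ e^{1/4} e^{-n/(4L)}` for all `n` (`triLRCrossingProb_square_exp_le`).
* Longer parallelograms (Remark 40), by elementary geometry instead of the RSW rate at `1`:
  an open left–right crossing of `[0, a] × [0, k a]` either crosses one of the `k` bands
  `[0, a] × [i a, (i+1) a]` from bottom to top or stays inside one of the `k - 1` windows
  `[0, a] × [j a, (j+2) a]` (`PathIn.band_or_window_mul`, the lowest/highest reachable site and a
  slab sub-path, as in `TriBlockCrossing.lean`), so
  `P_p(LR(a, k a)) ≤ (k-1) P_p(LR(a, 2a)) + k P_p(LR(a, a))` (`triLRCrossingProb_tall_le`); with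
  `a = a_j`, `a_j ≤ n ≤ 2a_j`, anti-monotonicity in the width and monotonicity in the height,
  `P_p(LR(n, k n)) ≤ P_p(LR(a_j, 2k a_j)) ≤ 4k e^{1/4} e^{-n/(8L)}`
  (`triLRCrossingProb_long_exp_le`).

## References

* P. Nolin, Near-critical percolation in two dimensions, *Electron. J. Probab.* 13 (2008), Thm. 2
  (RSW), §7.4 Lemma 39, Remark 40 (arXiv 0711.4948: Thm. 2, Lemma 37, Remark 38) [Nolin2008].
* S. Smirnov, W. Werner, *Math. Res. Lett.* 8 (2001), §2 [SmirnovWernerMRL2001].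
* H. Kesten, Scaling relations for 2D-percolation, *Comm. Math. Phys.* 109 (1987)
  [KestenScalingCMP1987].

Tree: `PathIn.exists_slab_crossing` (`TriPathCrossings.lean`), `PathIn.restrict`
(`SiteSharpnessStep.lean`), `triHCross`, `triVCross`, `triSitePercolation_real_triHCross/VCross`,
`triHCross_zero_zero`, `triLRCrossingProb_anti_width` (`TriRSWChaining.lean`),
`triLRCrossingProb_mono_height` (`TriShiftedCrossings.lean`), `triLRCrossingProb_block_iterate`,
`triLRCrossingProb_square_le_easy` (`TriBlockIteration.lean`), `triLRCrossingProb_add_eq_one`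
(`TriHexExclusive.lean`), `charLength`, `triTheta_exponent_of_scaling_at` (`KestenScaling.lean`),
`Nolin2008_prop34_of_expDecay`, `Nolin2008_subcritical_crossing_of_expDecay`
(`KestenRelationRussoProofs.lean`), `Nolin2008_cor41_at_of_ladder` (`NearCriticalArm.lean`),
`BollobasRiordan2006_tri_expDecay_holds` (`TriSubcriticalCrossingProofs.lean`), `tri_rsw_half_holds`
(`TriThetaHalf.lean`), `Nolin2008_RSW_one`, `Nolin2008_RSW_one_of_RSW_thm`
(`NearCriticalCorrelationLengthLower.lean`), `Nolin2008_lemma39_at`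
(`NearCriticalCorrelationLength.lean`). Mathlib: `Real.exp`, `Nat.log`; no percolation.
-/

noncomputable section

open MeasureTheory Set Filter Topology
open scoped unitInterval

namespace Literature.Probability.Percolation

open LatticeModels

/-! ### Elementary facts on crossing probabilities -/

/-- The single-site parallelogram `[0, 0]²` is crossed iff the origin is open: probability `p`. [folklore] -/
theorem triLRCrossingProb_zero_zero (p : unitInterval) : triLRCrossingProb p 0 0 = p := by
  have hset : triLRCrossing 0 0 = {ω : SiteConfig (Site 2) | (0 : Site 2) ∈ ω} := by
    ext ω
    rw [mem_triLRCrossing_iff]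
    constructor
    · rintro ⟨x, hx, y, -, hxy⟩
      have hx' := mem_rectangle_iff.1 (Finset.mem_filter.1 hx).1
      have hx0 : x = 0 := by ext i; fin_cases i <;> simp <;> omega
      subst hx0
      exact hxy.1
    · intro h0
      refine ⟨0, Finset.mem_filter.2 ⟨mem_rectangle_iff.2 (by simp), rfl⟩, 0,
        Finset.mem_filter.2 ⟨mem_rectangle_iff.2 (by simp), by simp⟩, ?_⟩
      exact mem_siteConnIn_self triGraph h0 (Finset.mem_coe.2 (mem_rectangle_iff.2 (by simp)))
  rw [triLRCrossingProb, hset, triSitePercolation, sitePercolation_real_mem]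

/-- For `ε < p < 1/2`, the characteristic length is at least `1`. [folklore] -/
theorem one_le_charLength (hsub : Nolin2008_subcritical_crossing) {ε : ℝ} (hε : 0 < ε)
    {p : unitInterval} (hεp : ε < p) (hp : (p : ℝ) < 1 / 2) : 1 ≤ charLength ε p :=
  le_charLength_of_forall_lt hsub hε hp fun n hn => by
    have : n = 0 := by omega
    subst this
    rwa [triLRCrossingProb_zero_zero]

/-! ### Band or window: crossings of tall parallelograms -/

/-- **Band or window, `k` bands.** Let `a ≥ 1`, `k ≥ 2`, and let `S` be a set of sites at heights
in `[0, k a]`. A `𝕋`-path with sites in `S` from `s` to `t` either yields a bottom-to-top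
crossing, inside `S`, of some band `{i a ≤ x₁ ≤ (i+1) a}` with `i < k`, or can be re-routed
inside `S` within some window `{j a ≤ x₁ ≤ (j+2) a}` with `j + 2 ≤ k` (lowest and highest sites
reachable from `s` inside `S`, and a slab sub-path; the `k`-band version of
`PathIn.band_or_window`, `TriBlockCrossing.lean`). [cite: Nolin2008, §7.4, Lemma 39 (proof, eq. (7.21)) and Remark 40 (arXiv 0711.4948: Lemma 37, Remark 38)] -/
theorem PathIn.band_or_window_mul {S : Set (Site 2)} {a : ℤ} (ha : 1 ≤ a)
    {k : ℕ} (hk : 2 ≤ k) (hS : ∀ z ∈ S, 0 ≤ z 1 ∧ z 1 ≤ k * a) {s t : Site 2}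
    (h : PathIn triGraph S s t) :
    (∃ i : ℕ, i < k ∧ ∃ u v : Site 2, u 1 = i * a ∧ v 1 = i * a + a ∧
        PathIn triGraph (S ∩ {z | (i : ℤ) * a ≤ z 1 ∧ z 1 ≤ i * a + a}) u v) ∨
      ∃ j : ℕ, j + 2 ≤ k ∧
        PathIn triGraph (S ∩ {z | (j : ℤ) * a ≤ z 1 ∧ z 1 ≤ j * a + 2 * a}) s t := by
  classical
  -- the sites reachable from `s` inside `S`, and their lowest / highest heights
  set C : Set (Site 2) := {z | PathIn triGraph S s z} with hC
  have hsC : s ∈ C := PathIn.refl h.left_mem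
  have hCS : ∀ z ∈ C, z ∈ S := fun z hz => PathIn.right_mem hz
  have hka : (0 : ℤ) ≤ k * a := by positivity
  have hex_lo : ∃ m : ℕ, ∃ z ∈ C, z 1 = m := ⟨(s 1).toNat, s, hsC, by
    rw [Int.toNat_of_nonneg (hS s h.left_mem).1]⟩
  obtain ⟨zlo, hzloC, hzlo⟩ := Nat.find_spec hex_lo
  have hlo_min : ∀ z ∈ C, zlo 1 ≤ z 1 := by
    intro z hz
    have h0 := (hS z (hCS z hz)).1
    have := Nat.find_min' hex_lo ⟨z, hz, (Int.toNat_of_nonneg h0).symm⟩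
    rw [hzlo]; omega
  have hex_hi : ∃ m : ℕ, ∃ z ∈ C, z 1 = k * a - m := ⟨(k * a - s 1).toNat, s, hsC, by
    rw [Int.toNat_of_nonneg (by linarith [(hS s h.left_mem).2])]; ring⟩
  obtain ⟨zhi, hzhiC, hzhi⟩ := Nat.find_spec hex_hi
  have hhi_max : ∀ z ∈ C, z 1 ≤ zhi 1 := by
    intro z hz
    have h1 := (hS z (hCS z hz)).2
    have := Nat.find_min' hex_hi ⟨z, hz, show z 1 = k * a - ((k * a - z 1).toNat : ℕ) by
      rw [Int.toNat_of_nonneg (by linarith)]; ring⟩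
    rw [hzhi]; omega
  have hlo0 : 0 ≤ zlo 1 := (hS zlo (hCS zlo hzloC)).1
  have hhiH : zhi 1 ≤ k * a := (hS zhi (hCS zhi hzhiC)).2
  -- a path inside `S` from the lowest to the highest reachable site
  have hpath : PathIn triGraph S zlo zhi := (PathIn.symm hzloC).trans hzhiC
  -- band index of the lowest site
  set i₁ : ℤ := zlo 1 / a with hi₁
  have ha0 : 0 < a := by linarith
  have hi₁0 : 0 ≤ i₁ := Int.ediv_nonneg hlo0 ha0.le
  have hi₁lo : i₁ * a ≤ zlo 1 := Int.ediv_mul_le _ ha0.ne'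
  have hi₁hi : zlo 1 < i₁ * a + a := by
    have := Int.lt_ediv_add_one_mul_self (zlo 1) ha0
    linarith [this]
  by_cases hband : ∃ i : ℕ, i < k ∧ zlo 1 ≤ i * a ∧ (i : ℤ) * a + a ≤ zhi 1
  · -- some band is crossed
    obtain ⟨i, hik, hilo, hihi⟩ := hband
    left
    obtain ⟨u, v, hu, hv, hq⟩ := hpath.exists_slab_crossing 1 (by linarith) hilo hihi
    exact ⟨i, hik, u, v, hu, hv, hq⟩
  · -- no band crossed: the reachable set lies in the window `j = min i₁ (k - 2)`
    right
    push Not at hband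
    have hk2 : (2 : ℤ) ≤ k := by exact_mod_cast hk
    set j : ℤ := min i₁ (k - 2) with hj
    have hj0 : 0 ≤ j := le_min hi₁0 (by linarith)
    have hwin : ∀ z ∈ C, j * a ≤ z 1 ∧ z 1 ≤ j * a + 2 * a := by
      intro z hz
      have hzlo := hlo_min z hz
      have hzhi := hhi_max z hz
      rcases le_or_gt (i₁ + 2) k with hi2 | hi2
      · -- band `i₁ + 1 < k` is not crossed
        have hmin : j = i₁ := min_eq_left (by linarith)
        rw [hmin]
        have key := hband (i₁ + 1).toNat (by omega)
        have hcast : (((i₁ + 1).toNat : ℕ) : ℤ) = i₁ + 1 := Int.toNat_of_nonneg (by linarith)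
        rw [hcast] at key
        have : zhi 1 < (i₁ + 1) * a + a := key (by linarith)
        constructor
        · linarith
        · nlinarith
      · have hmin : j = k - 2 := min_eq_right (by linarith)
        rw [hmin]
        constructor
        · nlinarith
        · linarith
    refine ⟨j.toNat, by omega, ?_⟩
    have hcast : ((j.toNat : ℕ) : ℤ) = j := Int.toNat_of_nonneg hj0
    rw [hcast]
    exact h.restrict.mono fun z hz => ⟨hz.1, hwin z hz.2⟩

/-- **A crossing of a tall parallelogram crosses a band or stays in a window**: for `a ≥ 1` and
`k ≥ 2`, an open left–right crossing of `[0, a] × [0, k a]` gives an open horizontal crossing of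
some window `[0, a] × [j a, (j+2) a]` (`j + 2 ≤ k`) or an open vertical crossing of some band
`[0, a] × [i a, (i+1) a]` (`i < k`). [cite: Nolin2008, §7.4, Remark 40 (arXiv 0711.4948: Remark 38)] -/
theorem triLRCrossing_tall_subset {a : ℕ} (ha : 1 ≤ a) {k : ℕ} (hk : 2 ≤ k) :
    triLRCrossing a (k * a) ⊆
      (⋃ j ∈ Finset.range (k - 1), triHCross 0 ((j : ℤ) * a) a (2 * a)) ∪
        ⋃ i ∈ Finset.range k, triVCross 0 ((i : ℤ) * a) a a := by
  intro ω hω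
  rw [← triHCross_zero_zero] at hω
  obtain ⟨x, y, hx, hy, hP⟩ := hω
  have hS : ∀ z ∈ triStrip 0 0 a (k * a) ∩ ω, 0 ≤ z 1 ∧ z 1 ≤ (k : ℤ) * a := by
    rintro z ⟨hz, -⟩
    rw [mem_triStrip] at hz
    push_cast at hz
    exact ⟨hz.2.2.1, by linarith [hz.2.2.2]⟩
  rcases hP.band_or_window_mul (a := (a : ℤ)) (by exact_mod_cast ha) hk hS with
    ⟨i, hik, u, v, hu, hv, hq⟩ | ⟨j, hjk, hq⟩
  · refine Set.mem_union_right _ (Set.mem_biUnion (Finset.mem_range.2 hik) ?_)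
    refine ⟨u, v, hu, by rw [hv], hq.mono ?_⟩
    rintro z ⟨⟨hz, hzω⟩, hz1, hz2⟩
    rw [mem_triStrip] at hz
    refine ⟨?_, hzω⟩
    rw [mem_triStrip]
    exact ⟨hz.1, hz.2.1, hz1, by linarith⟩
  · have hj : j ∈ Finset.range (k - 1) := Finset.mem_range.2 (by omega)
    refine Set.mem_union_left _ (Set.mem_biUnion hj ?_)
    refine ⟨x, y, hx, by rw [hy], hq.mono ?_⟩
    rintro z ⟨⟨hz, hzω⟩, hz1, hz2⟩
    rw [mem_triStrip] at hz
    refine ⟨?_, hzω⟩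
    rw [mem_triStrip]
    exact ⟨hz.1, hz.2.1, hz1, by push_cast; linarith⟩

/-- **Crossing probabilities of tall parallelograms**: for `a ≥ 1` and `k ≥ 2`,
`P_p(LR(a, k a)) ≤ (k - 1) P_p(LR(a, 2a)) + k P_p(LR(a, a))` (union bound over the windows and
bands of `triLRCrossing_tall_subset`, translation invariance, and `P_p(TB(a, a)) = P_p(LR(a, a))`).
[cite: Nolin2008, §7.4, Remark 40 (arXiv 0711.4948: Remark 38)] -/
theorem triLRCrossingProb_tall_le (p : unitInterval) {a : ℕ} (ha : 1 ≤ a) {k : ℕ} (hk : 2 ≤ k) :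
    triLRCrossingProb p a (k * a) ≤
      (k - 1) * triLRCrossingProb p a (2 * a) + k * triLRCrossingProb p a a := by
  have hW : (triSitePercolation p).real (⋃ j ∈ Finset.range (k - 1), triHCross 0 ((j : ℤ) * a) a (2 * a)) ≤
      (k - 1) * triLRCrossingProb p a (2 * a) := by
    calc (triSitePercolation p).real (⋃ j ∈ Finset.range (k - 1), triHCross 0 ((j : ℤ) * a) a (2 * a))
        ≤ ∑ j ∈ Finset.range (k - 1), (triSitePercolation p).real (triHCross 0 ((j : ℤ) * a) a (2 * a)) :=
          measureReal_biUnion_finset_le _ _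
      _ = ∑ _j ∈ Finset.range (k - 1), triLRCrossingProb p a (2 * a) :=
          Finset.sum_congr rfl fun j _ => triSitePercolation_real_triHCross p 0 _ a (2 * a)
      _ = (k - 1) * triLRCrossingProb p a (2 * a) := by
          rw [Finset.sum_const, Finset.card_range, nsmul_eq_mul, Nat.cast_sub (by omega), Nat.cast_one]
  have hB : (triSitePercolation p).real (⋃ i ∈ Finset.range k, triVCross 0 ((i : ℤ) * a) a a) ≤
      k * triLRCrossingProb p a a := by
    calc (triSitePercolation p).real (⋃ i ∈ Finset.range k, triVCross 0 ((i : ℤ) * a) a a)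
        ≤ ∑ i ∈ Finset.range k, (triSitePercolation p).real (triVCross 0 ((i : ℤ) * a) a a) :=
          measureReal_biUnion_finset_le _ _
      _ = ∑ _i ∈ Finset.range k, triLRCrossingProb p a a :=
          Finset.sum_congr rfl fun i _ => triSitePercolation_real_triVCross p 0 _ a a
      _ = k * triLRCrossingProb p a a := by
          rw [Finset.sum_const, Finset.card_range, nsmul_eq_mul]
  calc triLRCrossingProb p a (k * a)
      ≤ (triSitePercolation p).real
          ((⋃ j ∈ Finset.range (k - 1), triHCross 0 ((j : ℤ) * a) a (2 * a)) ∪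
            ⋃ i ∈ Finset.range k, triVCross 0 ((i : ℤ) * a) a a) :=
        measureReal_mono (triLRCrossing_tall_subset ha hk) (measure_ne_top _ _)
    _ ≤ (triSitePercolation p).real (⋃ j ∈ Finset.range (k - 1), triHCross 0 ((j : ℤ) * a) a (2 * a)) +
          (triSitePercolation p).real (⋃ i ∈ Finset.range k, triVCross 0 ((i : ℤ) * a) a a) :=
        measureReal_union_le _ _
    _ ≤ (k - 1) * triLRCrossingProb p a (2 * a) + k * triLRCrossingProb p a a := add_le_add hW hB

/-! ### The start of the block argument: easy crossings at scale `L_ε(p)` -/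

/-- **Easy crossings at the characteristic length are rare when `ε` is small** (Nolin 2008,
proof of Lemma 39: "The RSW theory thus entails that for all fixed `ε₁ > 0`, we can take `ε₀`
sufficiently small to get automatically (and independently of `p`) that
`P_p(C_H([0, L(p)] × [0, 2L(p)])) ≤ ε₁`"): if `δ₀ ≤ P_q(LR(n, n))` forces
`1 - η ≤ P_q(LR(2n, n))` (all `q`, `n ≥ 1`), then for `0 < ε ≤ 1 - δ₀`, `ε < p < 1/2` and
`L = L_ε(p)`, `P_p(LR(L, 2L)) ≤ η`: by Hex duality and transposition
(`triLRCrossingProb_add_eq_one`) `P_{1-p}(LR(L, L)) = 1 - P_p(LR(L, L)) ≥ 1 - ε ≥ δ₀` and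
`P_p(LR(L, 2L)) = 1 - P_{1-p}(LR(2L, L))`. [cite: Nolin2008, §7.4, Lemma 39 (proof, eq. (7.23); arXiv 0711.4948: Lemma 37)] -/
theorem triLRCrossingProb_charLength_easy_le (hsub : Nolin2008_subcritical_crossing)
    {δ₀ η : ℝ}
    (hone : ∀ (q : unitInterval) (n : ℕ), 1 ≤ n →
      δ₀ ≤ triLRCrossingProb q n n → 1 - η ≤ triLRCrossingProb q (2 * n) n)
    {ε : ℝ} (hε : 0 < ε) (hεδ : ε ≤ 1 - δ₀) {p : unitInterval} (hεp : ε < p)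
    (hp : (p : ℝ) < 1 / 2) :
    triLRCrossingProb p (charLength ε p) (2 * charLength ε p) ≤ η := by
  set L := charLength ε p with hL
  have hL1 : 1 ≤ L := one_le_charLength hsub hε hεp hp
  have hsq : triLRCrossingProb p L L ≤ ε := triLRCrossingProb_charLength_le' hsub hε hp
  have hdual : triLRCrossingProb (σ p) L L = 1 - triLRCrossingProb p L L := by
    have := triLRCrossingProb_add_eq_one p L L; linarith
  have h1 := triLRCrossingProb_add_eq_one p L (2 * L)
  have h3 : δ₀ ≤ triLRCrossingProb (σ p) L L := by rw [hdual]; linarith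
  have h2 : 1 - η ≤ triLRCrossingProb (σ p) (2 * L) L := hone (σ p) L hL1 h3
  linarith

/-! ### Squares: Lemma 39 for `k = 1` -/

/-- **Exponential decay of square crossings above `L(p)`** (Nolin 2008, proof of Lemma 39,
(7.21)–(7.23) and the final display): if the easy crossing at the characteristic length satisfies
`100 · P_p(LR(L, 2L)) ≤ e^{-1}` (`L = L_ε(p)`, `ε < p < 1/2`), then for every `n`,
`P_p(LR(n, n)) ≤ e^{1/4} e^{-n / (4 L)}`: block iteration along `a_j + 1 = 2^j (L + 1)` and
`a_j ≤ n ≤ 2 a_j` for the right `j`; small `n < L` are absorbed in the constant. No RSW input. [cite: Nolin2008, §7.4, Lemma 39 (proof; arXiv 0711.4948: Lemma 37)] -/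
theorem triLRCrossingProb_square_exp_le (hsub : Nolin2008_subcritical_crossing)
    {ε : ℝ} (hε : 0 < ε) {p : unitInterval} (hεp : ε < p) (hp : (p : ℝ) < 1 / 2)
    (hq0L : 100 * triLRCrossingProb p (charLength ε p) (2 * charLength ε p) ≤ Real.exp (-1))
    (n : ℕ) :
    triLRCrossingProb p n n ≤
      Real.exp (1 / 4) * Real.exp (-((n : ℝ) / (4 * charLength ε p))) := by
  set L := charLength ε p with hL
  have hL1 : 1 ≤ L := one_le_charLength hsub hε hεp hp
  have hLpos : (0 : ℝ) < L := by exact_mod_cast hL1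
  have hPle1 : triLRCrossingProb p n n ≤ 1 := (triLRCrossingProb_mem_Icc p n n).2
  have hq0 : 100 * triLRCrossingProb p L (2 * L) ≤ Real.exp (-1) := by rw [hL]; exact hq0L
  have hq0' : 0 ≤ 100 * triLRCrossingProb p L (2 * L) := by
    have := (triLRCrossingProb_mem_Icc p L (2 * L)).1; positivity
  rcases lt_or_ge n L with hnL | hnL
  · -- small `n`: absorbed in the constant
    calc triLRCrossingProb p n n ≤ 1 := hPle1
      _ = Real.exp (1 / 4) * Real.exp (-(1 / 4)) := by rw [← Real.exp_add]; norm_num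
      _ ≤ Real.exp (1 / 4) * Real.exp (-((n : ℝ) / (4 * L))) := by
          apply mul_le_mul_of_nonneg_left _ (Real.exp_pos _).le
          apply Real.exp_le_exp.2
          have : (n : ℝ) < L := by exact_mod_cast hnL
          have h4 : (n : ℝ) / (4 * L) ≤ 1 / 4 := by
            rw [div_le_iff₀ (by positivity)]; linarith
          linarith
  · -- `n ≥ L`: choose `j` with `a_j ≤ n ≤ 2 a_j`, `a_j + 1 = 2^j (L + 1)`
    set t : ℕ := (n + 1) / (L + 1) with ht
    have ht1 : 1 ≤ t := (Nat.one_le_div_iff (by omega)).2 (by omega)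
    set j : ℕ := Nat.log 2 t with hj
    have hj1 : 2 ^ j ≤ t := Nat.pow_log_le_self 2 (by omega)
    have hj2 : t < 2 ^ (j + 1) := Nat.lt_pow_succ_log_self (by norm_num) t
    have htL : t * (L + 1) ≤ n + 1 := Nat.div_mul_le_self _ _
    have htL' : n + 1 < (t + 1) * (L + 1) := by
      have h := Nat.lt_div_mul_add (a := n + 1) (b := L + 1) (by omega)
      rw [← ht] at h
      calc n + 1 < t * (L + 1) + (L + 1) := h
        _ = (t + 1) * (L + 1) := by ring
    have hpow : 2 ^ j * (L + 1) ≤ t * (L + 1) := Nat.mul_le_mul_right _ hj1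
    have hpow' : (t + 1) * (L + 1) ≤ 2 ^ (j + 1) * (L + 1) := Nat.mul_le_mul_right _ hj2
    have ha1 : 2 ^ j * (L + 1) - 1 ≤ n := by omega
    have ha2 : n ≤ 2 * (2 ^ j * (L + 1) - 1) := by
      have : 2 ^ (j + 1) * (L + 1) = 2 * (2 ^ j * (L + 1)) := by rw [pow_succ]; ring
      omega
    have hiter := triLRCrossingProb_block_iterate p hL1 j
    have hsq := triLRCrossingProb_square_le_easy p ha1 ha2
    -- `100 P ≤ (100 q₀)^{2^j} ≤ e^{-2^j}`
    have hA : 100 * triLRCrossingProb p n n ≤ Real.exp (-(2 : ℝ) ^ j) := by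
      calc 100 * triLRCrossingProb p n n
          ≤ 100 * triLRCrossingProb p (2 ^ j * (L + 1) - 1) (2 * (2 ^ j * (L + 1) - 1)) :=
            mul_le_mul_of_nonneg_left hsq (by norm_num)
        _ ≤ (100 * triLRCrossingProb p L (2 * L)) ^ 2 ^ j := hiter
        _ ≤ Real.exp (-1) ^ 2 ^ j := pow_le_pow_left₀ hq0' hq0 _
        _ = Real.exp (-(2 : ℝ) ^ j) := by
            have hc : ((2 ^ j : ℕ) : ℝ) * (-1) = -(2 : ℝ) ^ j := by push_cast; ring
            rw [← Real.exp_nat_mul, hc]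
    -- `2^j ≥ n / (4L)`
    have hB : (n : ℝ) / (4 * L) ≤ (2 : ℝ) ^ j := by
      have h1 : ((n : ℝ) + 1) < ((t : ℝ) + 1) * ((L : ℝ) + 1) := by exact_mod_cast htL'
      have h2 : ((t : ℝ) + 1) ≤ (2 : ℝ) ^ (j + 1) := by exact_mod_cast hj2
      have hL1' : (1 : ℝ) ≤ L := by exact_mod_cast hL1
      rw [div_le_iff₀ (by positivity)]
      have h3 : ((n : ℝ) + 1) < (2 : ℝ) ^ (j + 1) * ((L : ℝ) + 1) :=
        h1.trans_le (mul_le_mul_of_nonneg_right h2 (by positivity))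
      rw [pow_succ] at h3
      nlinarith
    calc triLRCrossingProb p n n = (100 * triLRCrossingProb p n n) / 100 := by ring
      _ ≤ Real.exp (-(2 : ℝ) ^ j) / 100 := by gcongr
      _ ≤ Real.exp (-((n : ℝ) / (4 * L))) / 100 := by
          gcongr Real.exp ?_ / 100
          linarith
      _ ≤ Real.exp (1 / 4) * Real.exp (-((n : ℝ) / (4 * L))) := by
          rw [div_le_iff₀ (by norm_num : (0 : ℝ) < 100)]
          have h1 : (1 : ℝ) ≤ Real.exp (1 / 4) := Real.one_le_exp (by norm_num)
          have h0 : 0 < Real.exp (-((n : ℝ) / (4 * L))) := Real.exp_pos _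
          nlinarith

/-! ### Longer parallelograms: Lemma 39 with Remark 40 -/

/-- **Exponential decay of easy crossings above `L(p)`, every aspect ratio** (Nolin 2008, Lemma 39
with Remark 40): under the same start `100 · P_p(LR(L, 2L)) ≤ e^{-1}` (`L = L_ε(p)`,
`ε < p < 1/2`), for every `k ≥ 1` and `n ≥ 1`, `P_p(LR(n, k n)) ≤ 4k e^{1/4} e^{-n/(8L)}`:
for `n ≥ L` pick `j` with `a_j ≤ n ≤ 2a_j` (`a_j + 1 = 2^j (L+1)`); then
`P_p(LR(n, k n)) ≤ P_p(LR(a_j, 2k a_j)) ≤ (2k - 1) P_p(LR(a_j, 2a_j)) + 2k P_p(LR(a_j, a_j))`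
(`triLRCrossingProb_tall_le`) with `100 P_p(LR(a_j, 2a_j)) ≤ e^{-2^j} ≤ e^{-n/(4L)}`
(`triLRCrossingProb_block_iterate`) and `P_p(LR(a_j, a_j)) ≤ e^{1/4} e^{-a_j/(4L)} ≤ e^{1/4} e^{-n/(8L)}`
(`triLRCrossingProb_square_exp_le`); `n < L` is absorbed in the constant. [cite: Nolin2008, §7.4, Lemma 39 and Remark 40 (arXiv 0711.4948: Lemma 37, Remark 38)] -/
theorem triLRCrossingProb_long_exp_le (hsub : Nolin2008_subcritical_crossing)
    {ε : ℝ} (hε : 0 < ε) {p : unitInterval} (hεp : ε < p) (hp : (p : ℝ) < 1 / 2)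
    (hq0L : 100 * triLRCrossingProb p (charLength ε p) (2 * charLength ε p) ≤ Real.exp (-1))
    {k : ℕ} (hk : 1 ≤ k) {n : ℕ} (hn : 1 ≤ n) :
    triLRCrossingProb p n (k * n) ≤
      4 * k * Real.exp (1 / 4) * Real.exp (-((n : ℝ) / (8 * charLength ε p))) := by
  set L := charLength ε p with hL
  have hL1 : 1 ≤ L := one_le_charLength hsub hε hεp hp
  have hLpos : (0 : ℝ) < L := by exact_mod_cast hL1
  have hPle1 : triLRCrossingProb p n (k * n) ≤ 1 := (triLRCrossingProb_mem_Icc p n (k * n)).2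
  have hk1 : (1 : ℝ) ≤ k := by exact_mod_cast hk
  have hE0 : 0 < Real.exp (-((n : ℝ) / (8 * L))) := Real.exp_pos _
  have hq0 : 100 * triLRCrossingProb p L (2 * L) ≤ Real.exp (-1) := by rw [hL]; exact hq0L
  have hq0' : 0 ≤ 100 * triLRCrossingProb p L (2 * L) := by
    have := (triLRCrossingProb_mem_Icc p L (2 * L)).1; positivity
  rcases lt_or_ge n L with hnL | hnL
  · -- small `n`: `P ≤ 1 ≤ 4 k e^{1/4} e^{-1/8} ≤ 4 k e^{1/4} e^{-n/(8L)}`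
    have h8 : (n : ℝ) / (8 * L) ≤ 1 / 8 := by
      rw [div_le_iff₀ (by positivity)]
      have : (n : ℝ) < L := by exact_mod_cast hnL
      linarith
    have hE78 : (7 / 8 : ℝ) ≤ Real.exp (-((n : ℝ) / (8 * L))) := by
      have h1 : Real.exp (-(1 / 8 : ℝ)) ≤ Real.exp (-((n : ℝ) / (8 * L))) :=
        Real.exp_le_exp.2 (by linarith)
      have h0 : (7 / 8 : ℝ) ≤ Real.exp (-(1 / 8 : ℝ)) := by
        have := Real.add_one_le_exp (-(1 / 8 : ℝ)); linarith
      linarith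
    have h4k : (4 : ℝ) ≤ 4 * k * Real.exp (1 / 4) := by
      have h1 : (1 : ℝ) ≤ Real.exp (1 / 4) := Real.one_le_exp (by norm_num)
      have := mul_le_mul (mul_le_mul_of_nonneg_left hk1 (by norm_num : (0 : ℝ) ≤ 4)) h1
        zero_le_one (by positivity)
      norm_num at this
      exact this
    calc triLRCrossingProb p n (k * n) ≤ 1 := hPle1
      _ ≤ 4 * (7 / 8) := by norm_num
      _ ≤ 4 * k * Real.exp (1 / 4) * Real.exp (-((n : ℝ) / (8 * L))) :=
          mul_le_mul h4k hE78 (by norm_num) (by positivity)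
  · -- `n ≥ L`: choose `j` with `a_j ≤ n ≤ 2 a_j`, `a_j + 1 = 2^j (L + 1)`
    set t : ℕ := (n + 1) / (L + 1) with ht
    have ht1 : 1 ≤ t := (Nat.one_le_div_iff (by omega)).2 (by omega)
    set j : ℕ := Nat.log 2 t with hj
    have hj1 : 2 ^ j ≤ t := Nat.pow_log_le_self 2 (by omega)
    have hj2 : t < 2 ^ (j + 1) := Nat.lt_pow_succ_log_self (by norm_num) t
    have htL : t * (L + 1) ≤ n + 1 := Nat.div_mul_le_self _ _
    have htL' : n + 1 < (t + 1) * (L + 1) := by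
      have h := Nat.lt_div_mul_add (a := n + 1) (b := L + 1) (by omega)
      rw [← ht] at h
      calc n + 1 < t * (L + 1) + (L + 1) := h
        _ = (t + 1) * (L + 1) := by ring
    have hpow : 2 ^ j * (L + 1) ≤ t * (L + 1) := Nat.mul_le_mul_right _ hj1
    have hpow' : (t + 1) * (L + 1) ≤ 2 ^ (j + 1) * (L + 1) := Nat.mul_le_mul_right _ hj2
    set A : ℕ := 2 ^ j * (L + 1) - 1 with hA
    have hA1 : 1 ≤ A := by
      have : L + 1 ≤ 2 ^ j * (L + 1) := Nat.le_mul_of_pos_left _ (by positivity)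
      omega
    have ha1 : A ≤ n := by omega
    have ha2 : n ≤ 2 * A := by
      have : 2 ^ (j + 1) * (L + 1) = 2 * (2 ^ j * (L + 1)) := by rw [pow_succ]; ring
      omega
    -- `100 P(LR(a_j, 2 a_j)) ≤ e^{-2^j}`
    have hiter := triLRCrossingProb_block_iterate p hL1 j
    have hEasy : 100 * triLRCrossingProb p A (2 * A) ≤ Real.exp (-(2 : ℝ) ^ j) := by
      calc 100 * triLRCrossingProb p A (2 * A)
          ≤ (100 * triLRCrossingProb p L (2 * L)) ^ 2 ^ j := hiter
        _ ≤ Real.exp (-1) ^ 2 ^ j := pow_le_pow_left₀ hq0' hq0 _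
        _ = Real.exp (-(2 : ℝ) ^ j) := by
            have hc : ((2 ^ j : ℕ) : ℝ) * (-1) = -(2 : ℝ) ^ j := by push_cast; ring
            rw [← Real.exp_nat_mul, hc]
    -- `2^j ≥ n / (4L)` and `a_j ≥ n / 2`
    have hB : (n : ℝ) / (4 * L) ≤ (2 : ℝ) ^ j := by
      have h1 : ((n : ℝ) + 1) < ((t : ℝ) + 1) * ((L : ℝ) + 1) := by exact_mod_cast htL'
      have h2 : ((t : ℝ) + 1) ≤ (2 : ℝ) ^ (j + 1) := by exact_mod_cast hj2
      have hL1' : (1 : ℝ) ≤ L := by exact_mod_cast hL1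
      rw [div_le_iff₀ (by positivity)]
      have h3 : ((n : ℝ) + 1) < (2 : ℝ) ^ (j + 1) * ((L : ℝ) + 1) :=
        h1.trans_le (mul_le_mul_of_nonneg_right h2 (by positivity))
      rw [pow_succ] at h3
      nlinarith
    have hAn : (n : ℝ) ≤ 2 * A := by exact_mod_cast ha2
    -- squares at scale `a_j`
    have hSq : triLRCrossingProb p A A ≤ Real.exp (1 / 4) * Real.exp (-((n : ℝ) / (8 * L))) := by
      refine (triLRCrossingProb_square_exp_le hsub hε hεp hp hq0L A).trans ?_
      rw [← hL]
      apply mul_le_mul_of_nonneg_left _ (Real.exp_pos _).le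
      apply Real.exp_le_exp.2
      rw [neg_le_neg_iff, div_le_div_iff₀ (by positivity) (by positivity)]
      nlinarith
    have hEasy' : triLRCrossingProb p A (2 * A) ≤ Real.exp (-((n : ℝ) / (8 * L))) / 100 := by
      rw [le_div_iff₀ (by norm_num : (0 : ℝ) < 100), mul_comm]
      refine hEasy.trans (Real.exp_le_exp.2 ?_)
      have : (n : ℝ) / (8 * L) ≤ (n : ℝ) / (4 * L) :=
        div_le_div_of_nonneg_left (by positivity) (by positivity) (by linarith)
      linarith
    -- geometry: `P(LR(n, k n)) ≤ P(LR(A, 2k A)) ≤ (2k-1) P(LR(A, 2A)) + 2k P(LR(A, A))`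
    have hk2 : 2 ≤ 2 * k := by omega
    have hgeom := triLRCrossingProb_tall_le p hA1 hk2
    have hmono : triLRCrossingProb p n (k * n) ≤ triLRCrossingProb p A (2 * k * A) :=
      (triLRCrossingProb_anti_width p ha1 (k * n)).trans
        (triLRCrossingProb_mono_height p A (by nlinarith))
    have hcast : ((2 * k : ℕ) : ℝ) = 2 * (k : ℝ) := by push_cast; ring
    rw [hcast] at hgeom
    have hP2 : 0 ≤ triLRCrossingProb p A (2 * A) := (triLRCrossingProb_mem_Icc p A (2 * A)).1
    have hP1 : 0 ≤ triLRCrossingProb p A A := (triLRCrossingProb_mem_Icc p A A).1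
    calc triLRCrossingProb p n (k * n) ≤ triLRCrossingProb p A (2 * k * A) := hmono
      _ ≤ (2 * (k : ℝ) - 1) * triLRCrossingProb p A (2 * A) + 2 * (k : ℝ) * triLRCrossingProb p A A :=
          hgeom
      _ ≤ (2 * (k : ℝ) - 1) * (Real.exp (-((n : ℝ) / (8 * L))) / 100) +
            2 * (k : ℝ) * (Real.exp (1 / 4) * Real.exp (-((n : ℝ) / (8 * L)))) :=
          add_le_add (mul_le_mul_of_nonneg_left hEasy' (by linarith))
            (mul_le_mul_of_nonneg_left hSq (by positivity))
      _ ≤ 4 * k * Real.exp (1 / 4) * Real.exp (-((n : ℝ) / (8 * L))) := by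
          have h1 : (1 : ℝ) ≤ Real.exp (1 / 4) := Real.one_le_exp (by norm_num)
          have hE := hE0.le
          -- `(2k-1)/100 + 2k e^{1/4} ≤ 4k e^{1/4}`
          have hc : (2 * (k : ℝ) - 1) / 100 + 2 * k * Real.exp (1 / 4) ≤ 4 * k * Real.exp (1 / 4) := by
            nlinarith
          have := mul_le_mul_of_nonneg_right hc hE
          linarith [this]

/-- **Uniform exponential decay above `L(p)`, small `ε`** (Nolin 2008, §7.4, Lemma 39 with
Remark 40 [arXiv 0711.4948: Lemma 37, Remark 38], "for any `ε` below some fixed value `ε₀` (given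
by RSW)"): from `Nolin2008_RSW_one` (only `k = 2`, `η = 1/(100 e)` is used) and the finiteness of
`L_ε` (`Nolin2008_subcritical_crossing`) there is a universal `ε₀ > 0` such that for every
`0 < ε ≤ ε₀` and `k ≥ 1` there are `C₁, C₂ > 0` with
`P_p(LR(n, k n)) ≤ C₁ e^{-C₂ n / L_ε(p)}` for all `ε < p < 1/2` and `n ≥ 1` — the body of the
named fact `Nolin2008_lemma39` (`NearCriticalArm.lean`) for these `ε`. [cite: Nolin2008, §7.4, Lemma 39 and Remark 40 (arXiv 0711.4948: Lemma 37, Remark 38)] -/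
theorem Nolin2008_lemma39_small (hone : Nolin2008_RSW_one)
    (hsub : Nolin2008_subcritical_crossing) :
    ∃ ε₀ > (0 : ℝ), ∀ ⦃ε : ℝ⦄, 0 < ε → ε ≤ ε₀ → ∀ k : ℕ, 1 ≤ k →
      ∃ C₁ > (0 : ℝ), ∃ C₂ > (0 : ℝ), ∀ p : unitInterval, ε < (p : ℝ) → (p : ℝ) < 1 / 2 →
        ∀ n : ℕ, 1 ≤ n →
          triLRCrossingProb p n (k * n) ≤ C₁ * Real.exp (-(C₂ * n / charLength ε p)) := by
  obtain ⟨δ₀, hδ₀, hδ₁, hδ⟩ := hone 2 le_rfl (1 / (100 * Real.exp 1)) (by positivity)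
  refine ⟨1 - δ₀, by linarith, fun ε hε hεle k hk => ?_⟩
  refine ⟨4 * k * Real.exp (1 / 4), by positivity, 1 / 8, by norm_num, fun p hεp hp n hn => ?_⟩
  -- the start: `100 P_p(LR(L, 2L)) ≤ e^{-1}`
  have heasy := triLRCrossingProb_charLength_easy_le hsub hδ hε hεle hεp hp
  have hq0L : 100 * triLRCrossingProb p (charLength ε p) (2 * charLength ε p) ≤ Real.exp (-1) := by
    have he : Real.exp (-1) = 1 / Real.exp 1 := by rw [Real.exp_neg, one_div]
    rw [he, le_div_iff₀ (Real.exp_pos 1)]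
    have := mul_le_mul_of_nonneg_right heasy (by positivity : (0 : ℝ) ≤ 100 * Real.exp 1)
    rw [div_mul_cancel₀ _ (by positivity)] at this
    linarith
  refine (triLRCrossingProb_long_exp_le hsub hε hεp hp hq0L hk hn).trans (le_of_eq ?_)
  congr 1
  congr 1
  ring

/-! ### Discharges and bridges -/

/-- **Discharge of `Nolin2008_subcritical_crossing`** (`KestenRelationRusso.lean`; Nolin 2008,
§2.2 "exponential decay … when `p < 1/2`", the input making `L_ε(p)` finite): from the exponential
decay of the radius below `1/2`, now a theorem (`BollobasRiordan2006_tri_expDecay_holds`,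
`TriSubcriticalCrossingProofs.lean`), through `Nolin2008_subcritical_crossing_of_expDecay`
(`KestenRelationRussoProofs.lean`). [cite: Nolin2008, §2.2 (exponential decay for p < 1/2) and §3.1] -/
theorem Nolin2008_subcritical_crossing_holds : Nolin2008_subcritical_crossing :=
  Nolin2008_subcritical_crossing_of_expDecay BollobasRiordan2006_tri_expDecay_holds

/-- **Nolin's Lemma 39 at one small `ε`, from `Nolin2008_RSW_one`**: for every `0 < ε ≤ ε₀`, the
single-`ε` statement `Nolin2008_lemma39_at ε` of `NearCriticalCorrelationLength.lean` (guard
`1 ≤ L_ε(p)`, all `n`) follows from `Nolin2008_lemma39_small` (guard `ε < p`, `n ≥ 1`):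
`1 ≤ L_ε(p)` forces `ε < P_p(LR(0, 0)) = p`, and `n = 0` is absorbed by taking `C₁ ≥ 1`.
[cite: Nolin2008, §7.4, Lemma 39 and Remark 40 (arXiv 0711.4948: Lemma 37, Remark 38)] -/
theorem Nolin2008_lemma39_at_small (hone : Nolin2008_RSW_one) :
    ∃ ε₀ > (0 : ℝ), ∀ ⦃ε : ℝ⦄, 0 < ε → ε ≤ ε₀ → Nolin2008_lemma39_at ε := by
  obtain ⟨ε₀, hε₀, h⟩ := Nolin2008_lemma39_small hone Nolin2008_subcritical_crossing_holds
  refine ⟨ε₀, hε₀, fun ε hε hεle k hk => ?_⟩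
  obtain ⟨C₁, hC₁, C₂, hC₂, hb⟩ := h hε hεle k hk
  refine ⟨max C₁ 1, lt_max_of_lt_left hC₁, C₂, hC₂, fun p hp hL n => ?_⟩
  have hεp : ε < (p : ℝ) := by
    have h0 := lt_triLRCrossingProb_of_lt_charLength (ε := ε) (p := p) (n := 0) hL
    rwa [min_symm_eq_self hp.le, triLRCrossingProb_zero_zero] at h0
  rcases Nat.eq_zero_or_pos n with hn | hn
  · subst hn
    rw [mul_zero, triLRCrossingProb_zero_zero, Nat.cast_zero, mul_zero, zero_div, neg_zero,
      Real.exp_zero, mul_one]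
    exact p.2.2.trans (le_max_right _ _)
  · exact (hb p hεp hp n hn).trans
      (mul_le_mul_of_nonneg_right (le_max_left _ _) (Real.exp_pos _).le)

/-! ### The assembly of crit-perc.S16 with small `ε` -/

/-- **`θ(p) ≍ π₁(L_ε(p))` at one `ε`** (the `ε`-local form of
`Nolin2008_theta_asymp_of_nearCritical`, Nolin 2008, §7.4, (7.25)): from the near-critical
stability of one arm at `ε` and `θ(p) ≥ c P_p(0 ↔ ∂Λ_{L_ε(p)})` at `ε`. [cite: Nolin2008, §7.4, eq. (7.25)] -/
theorem Nolin2008_theta_asymp_at_of_nearCritical {ε : ℝ}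
    (h27 : ∃ δ > (0 : ℝ), ∃ c > (0 : ℝ), ∃ C : ℝ,
      ∀ p : unitInterval, (p : ℝ) ≠ 1 / 2 → |(p : ℝ) - 1 / 2| < δ →
        ∀ N ≤ charLength ε p,
          c * critOneArmProb N ≤ (triSitePercolation p).real (triOneArm N) ∧
            (triSitePercolation p).real (triOneArm N) ≤ C * critOneArmProb N)
    (h41 : ∃ δ > (0 : ℝ), ∃ c > (0 : ℝ),
      ∀ p : unitInterval, 1 / 2 < (p : ℝ) → (p : ℝ) < 1 / 2 + δ →
        c * (triSitePercolation p).real (triOneArm (charLength ε p)) ≤ triTheta p) :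
    ∃ δ > (0 : ℝ), ∃ c > (0 : ℝ), ∃ C : ℝ,
      ∀ p : unitInterval, 1 / 2 < (p : ℝ) → (p : ℝ) < 1 / 2 + δ →
        c * critOneArmProb (charLength ε p) ≤ triTheta p ∧
          triTheta p ≤ C * critOneArmProb (charLength ε p) := by
  obtain ⟨δ₁, hδ₁, c₁, hc₁, C₁, h₁⟩ := h27
  obtain ⟨δ₂, hδ₂, c₂, hc₂, h₂⟩ := h41
  refine ⟨min δ₁ δ₂, lt_min hδ₁ hδ₂, c₂, hc₂, C₁, fun p hp hpδ => ?_⟩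
  have hpδ₁ : |(p : ℝ) - 1 / 2| < δ₁ := by
    rw [abs_of_pos (sub_pos.2 hp)]
    linarith [min_le_left δ₁ δ₂]
  have hhalf : half ≤ p := Subtype.coe_le_coe.1 (by rw [coe_half]; exact hp.le)
  constructor
  · calc c₂ * critOneArmProb (charLength ε p)
        ≤ c₂ * (triSitePercolation p).real (triOneArm (charLength ε p)) :=
          mul_le_mul_of_nonneg_left (critOneArmProb_le_real_triOneArm hhalf _) hc₂.le
      _ ≤ triTheta p := h₂ p hp (by linarith [min_le_right δ₁ δ₂])
  · calc triTheta p ≤ (triSitePercolation p).real (triOneArm (charLength ε p)) :=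
          triTheta_le_real_triOneArm p _
      _ ≤ C₁ * critOneArmProb (charLength ε p) := (h₁ p hp.ne' hpδ₁ _ le_rfl).2

/-- **crit-perc.S16 reduced to five named facts of the tree.** `θ(p) = (p - 1/2)^{5/36 + o(1)}`
as `p ↓ 1/2` (Smirnov–Werner 2001, Thm. 1; Kesten 1987) follows from: the critical arm exponents
`oneArm_exponent` (`5/48`, Lawler–Schramm–Werner 2002) and `fourArm_exponent` (`5/4`,
Smirnov–Werner 2001), the pivotal count below `L(p)` (`Werner2009_lemma62`), the near-critical
stability of one arm (`Nolin2008_thm27_oneArm`), and the RSW limit `f_k(δ) → 1`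
(`Nolin2008_RSW_one`). Work at `ε = min ε₀ (1/4)` with the `ε₀` of `Nolin2008_lemma39_small`:
`Nolin2008_prop34_of_expDecay` (with `BollobasRiordan2006_tri_expDecay_holds`),
`Nolin2008_cor41_at_of_ladder` (with `tri_rsw_half_holds`, the decay for `k = 4, 2`, and
`Nolin2008_subcritical_crossing_holds`), `Nolin2008_theta_asymp_at_of_nearCritical`,
`triTheta_exponent_of_scaling_at`. [cite: SmirnovWernerMRL2001, §2 (paragraph after the theorem "Behaviour near the critical point")] [cite: Nolin2008, §7.4] -/
theorem triTheta_exponent_of_leaves5 (h₁ : oneArm_exponent) (h₄ : fourArm_exponent)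
    (h62 : Werner2009_lemma62) (h27 : Nolin2008_thm27_oneArm) (hone : Nolin2008_RSW_one) :
    triTheta_exponent := by
  have hsub := Nolin2008_subcritical_crossing_holds
  obtain ⟨ε₀, hε₀, h39⟩ := Nolin2008_lemma39_small hone hsub
  set ε : ℝ := min ε₀ (1 / 4) with hεdef
  have hε : 0 < ε := lt_min hε₀ (by norm_num)
  have hε' : ε < 1 / 2 := (min_le_right _ _).trans_lt (by norm_num)
  have hεle : ε ≤ ε₀ := min_le_left _ _
  have h4 := h39 hε hεle 4 (by norm_num)
  have h2 := h39 hε hεle 2 (by norm_num)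
  have hcor := Nolin2008_cor41_at_of_ladder hε hε' tri_rsw_half_holds h4 h2 hsub
  exact triTheta_exponent_of_scaling_at h₁ h₄
    (Nolin2008_prop34_of_expDecay BollobasRiordan2006_tri_expDecay_holds h62 hε hε')
    (Nolin2008_theta_asymp_at_of_nearCritical (h27 hε hε') hcor)

/-- **crit-perc.S16 from the printed RSW theorem**: as `triTheta_exponent_of_leaves5`, with
`Nolin2008_RSW_one` derived from `Nolin2008_RSW_thm` (`Nolin2008_RSW_one_of_RSW_thm`,
`NearCriticalCorrelationLengthLower.lean`). [cite: SmirnovWernerMRL2001, §2 (paragraph after the theorem "Behaviour near the critical point")] [cite: Nolin2008, §7.4] -/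
theorem triTheta_exponent_of_leaves5' (h₁ : oneArm_exponent) (h₄ : fourArm_exponent)
    (h62 : Werner2009_lemma62) (h27 : Nolin2008_thm27_oneArm) (hRSW : Nolin2008_RSW_thm) :
    triTheta_exponent :=
  triTheta_exponent_of_leaves5 h₁ h₄ h62 h27 (Nolin2008_RSW_one_of_RSW_thm hRSW)

end Literature.Probability.Percolation
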